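import Literature.Analysis.FluidPDE.PressureRepresentation
import Literature.Analysis.FluidPDE.HessianLaplacian
import Literature.Analysis.FluidPDE.CurlFreeLiouville
import Literature.Analysis.FluidPDE.VorticityCalculus
import Literature.Analysis.FluidPDE.LocalBiotSavartCalculus
import Mathlib.Analysis.Calculus.LineDeriv.IntegrationByParts
import Literature.Analysis.FluidPDE.NSFourierAPriori
import HarnessLib

/-!
# Tao (2011/2013), proof of Thm. 10.1: the local velocity-gradient bound behind `Y₆`

Support file for the proof of the nonlinear estimate `Y₆` of Tao's enstrophy localisation
argument (T. Tao, *Localisation and compactness properties of the Navier–Stokes global regularity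
problem*, arXiv:1108.1165, §10, p. 32). Tao: "The first step is to convert `∇u` into an
expression that only involves `ω` (modulo lower order terms), while staying inside the domain
`Ω`. To do this, we first observe from the divergence-free nature of `u` that
`Δu = ∇ × ∇ × u = ∇ × ω`. Let `ψᵢ` be a smooth cutoff […] On `2Bᵢ`, we thus have the local
Biot-Savart law `u = O(Δ⁻¹∇(ψᵢω)) + v` where `v` is harmonic on `2Bᵢ` […] we thus have the
pointwise estimate `|∇u| ≲ |∇Δ⁻¹∇(ψᵢω)| + rᵢ^{-3/2}‖ω‖_{L²(2Bᵢ)} + rᵢ^{-5/2}‖u‖_{L²(2Bᵢ)}` on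
`Bᵢ`", with "`‖∇Δ⁻¹∇(ψᵢω)‖_{L²(ℝ³)} ≲ ‖ψᵢω‖_{L²(ℝ³)} ≲ ‖ω‖_{L²(2Bᵢ)}`" (Plancherel).

We prove this step (`exists_local_velocityGradient_bound`) in a boundary-free form that avoids
harmonic functions and the Fourier transform, using the tree's localised Newton kernel
`Γ₀ʳ = θΓ` (cut off at radii `(r, 2r)`) and `λʳ = Δ((1−θ)Γ)` (`NewtonKernel`,
`NewtonPotential`):

* `eq_integral_newtonNear_smul_laplacian_add` — the localised Green representation formula in
  vector form, `u(y) = ∫ Γ₀ʳ(z) Δu(y−z) dz + ∫ λʳ(z) u(y−z) dz`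
  (from `integral_newtonNear_mul_laplacian`, Gilbarg–Trudinger (2.17));
* `Δu = −curl curl u` for divergence-free `u` is the tree's `laplacian_eq_neg_curl_curl`
  (`LocalBiotSavartCalculus`);
* locality of `Γ₀ʳ` turns the first term, on `B(x₀, 2r)`, into `−curl A` with the **vector
  potential** `A = Γ₀ʳ * (ψω)` (`ψ = 1` on `B(x₀, 4r)`, `curl_integral_newtonNear_smul_comp_sub`);
* `integral_sq_norm_fderiv_curl_integral_newtonNear_le` — **`∫ |D curl A|² ≤ C ∫ |ψω|²`**, from
  the tree's Hessian–Laplacian identity `Σ∫(∂ᵢ∂ⱼG)² = ∫(ΔG)²` (`HessianLaplacian`, Stein 1970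
  Ch. III §1.3), `Δ(Γ₀ʳ * φ) = φ − λʳ * φ` and Young's inequality
  `‖λʳ * φ‖₂ ≤ ‖λʳ‖₁‖φ‖₂` (`integral_sq_integral_mul_comp_sub_le`, proved here from the tree's
  Cauchy–Schwarz `FourierNS.sq_integral_mul_le_of_integrable`; `‖λʳ‖₁` is scale-free);
* `norm_fderiv_integral_newtonFarLaplacian_smul_le` — the lower-order term:
  `‖D(λʳ * u)(y)‖ ≤ r⁻⁴‖Dλ‖_∞ ∫_{B(y,3r)}|u|` (the derivative falls on the kernel by an
  integration by parts; this replaces Tao's harmonic remainder `v` and the mean-value principle).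

The output is exactly what the Whitney-ball bookkeeping of p. 32 consumes: a function `F ≥ 0`
with `‖F‖²_{L²} ≲ ‖ω‖²_{L²(9B)}` and `|∇u| ≤ F + C r⁻⁴ ∫_{3B(y)} |u|` on `B`.

## Mathlib / tree search

Mathlib (this pin) has no Newtonian potential, Biot–Savart law or Young convolution inequality
for `L¹ × L²` (`Mathlib.Analysis.Convolution` has only `dist_convolution_le`-type bounds); the tree
has the localised Newton kernel calculus (`FluidPDE/NewtonKernel`, `NewtonPotential`,
`HarmonicProbe`: differentiation under the integral), the Hessian–Laplacian identity
(`FluidPDE/HessianLaplacian`) and the curl calculus (`VorticityCalculus`,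
`TaoEnstrophyLocalisation(Proofs)`, `CurlFreeLiouville`, and — landed while this file was written —
`LocalBiotSavartCalculus` (`Δ = −curl curl`, reused), `NewtonLocalPotential` /
`TruncatedNewtonHessian` (the scalar Hessian bound in convolution form; the present file keeps its
own short scalar section in the literal `∫ Γ₀ʳ(z) φ(· − z) dz` form consumed by the vector
statements below), `TaoY6KernelNorms` (kernel scalings)); no assembled local velocity-gradient
estimate (`lean search 'velocityGradient|LocalGradient'`).

## References

* T. Tao, *Localisation and compactness properties of the Navier–Stokes global regularity
  problem*, Anal. PDE 6 (2013) 25–107 = arXiv:1108.1165 (`Tao2011`), §10, proof of Thm. 10.1,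
  p. 32 (local Biot–Savart law, the bound for `F_i`).
* D. Gilbarg, N. S. Trudinger, *Elliptic partial differential equations of second order* (2001),
  (2.16)–(2.17) (`GilbargTrudinger2001`).
* E. M. Stein, *Singular integrals and differentiability properties of functions* (1970),
  Ch. III §1.3 (`Stein1971`).
-/

noncomputable section

open MeasureTheory Set Metric Filter Function InnerProductSpace
open scoped RealInnerProductSpace Laplacian ENNReal NNReal Topology

namespace Literature.Analysis.FluidPDE

section Kernels

variable {r : ℝ}

/-- The localised Newton kernel at scale `r`: `Γ₀ʳ = θ_{r,2r} Γ`, supported in `‖z‖ ≤ 2r`. [folklore] -/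
theorem newtonNear_scale_eq_zero (hr : 0 < r) {z : (EuclideanSpace ℝ (Fin 3))} (hz : 2 * r < ‖z‖) :
    newtonNear r (2 * r) z = 0 :=
  newtonNear_eq_zero hr.le (by linarith) hz.le

/-- `λʳ = Δ((1 − θ_{r,2r})Γ)` vanishes off `‖z‖ ≤ 2r`. [folklore] -/
theorem newtonFarLaplacian_scale_eq_zero (hr : 0 < r) {z : (EuclideanSpace ℝ (Fin 3))} (hz : 2 * r < ‖z‖) :
    newtonFarLaplacian r (2 * r) z = 0 :=
  newtonFarLaplacian_eq_zero_of_gt hr.le (by linarith) hz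

/-- **A uniform bound for `Dλ` at scale one**, `‖Dλ^{1,2}(z)‖ ≤ M₁`. [folklore] -/
theorem exists_bound_fderiv_newtonFarLaplacian_one_two :
    ∃ M₁ : ℝ, 0 ≤ M₁ ∧ ∀ z : (EuclideanSpace ℝ (Fin 3)), ‖fderiv ℝ (newtonFarLaplacian 1 2) z‖ ≤ M₁ := by
  have hc : Continuous (fderiv ℝ (newtonFarLaplacian 1 2)) :=
    (contDiff_newtonFarLaplacian one_pos one_lt_two (n := 1)).continuous_fderiv one_ne_zero
  obtain ⟨C, hC⟩ := hc.bounded_above_of_compact_support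
    ((hasCompactSupport_newtonFarLaplacian zero_le_one one_lt_two).fderiv (𝕜 := ℝ))
  exact ⟨max C 0, le_max_right _ _, fun z => (hC z).trans (le_max_left _ _)⟩

/-- **Scaling of `Dλ`**: `λ^{r,2r}(z) = r⁻³λ^{1,2}(z/r)`, so `‖Dλ^{r,2r}(z)‖ ≤ r⁻⁴ M₁`. [folklore] -/
theorem norm_fderiv_newtonFarLaplacian_scale_le (hr : 0 < r) {M₁ : ℝ}
    (hM : ∀ z : (EuclideanSpace ℝ (Fin 3)), ‖fderiv ℝ (newtonFarLaplacian 1 2) z‖ ≤ M₁) (z : (EuclideanSpace ℝ (Fin 3))) :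
    ‖fderiv ℝ (newtonFarLaplacian r (2 * r)) z‖ ≤ r⁻¹ ^ 4 * M₁ := by
  have hfun : newtonFarLaplacian r (2 * r) = fun w : (EuclideanSpace ℝ (Fin 3)) =>
      r⁻¹ ^ 3 • newtonFarLaplacian 1 2 (r⁻¹ • w) := by
    funext w
    have := newtonFarLaplacian_scale hr 1 2 w
    rw [mul_one, show r * 2 = 2 * r by ring] at this
    rw [this, smul_eq_mul]
  rw [hfun, fderiv_const_smul_comp_smul _ _ (inv_ne_zero hr.ne'), norm_smul,
    show r⁻¹ ^ 3 * r⁻¹ = r⁻¹ ^ 4 by ring, Real.norm_of_nonneg (by positivity)]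
  exact mul_le_mul_of_nonneg_left (hM _) (by positivity)

/-- `∫ |λ^{r,2r}| = ∫ |λ^{1,2}|`. [folklore] -/
theorem integral_abs_newtonFarLaplacian_scale_eq (hr : 0 < r) :
    ∫ z, |newtonFarLaplacian r (2 * r) z| = ∫ w, |newtonFarLaplacian 1 2 w| := by
  have := integral_abs_newtonFarLaplacian_scale hr 1 2
  rwa [mul_one, show r * 2 = 2 * r by ring] at this

end Kernels

section Young

/-- **Young's inequality `L¹ * L² → L²` for continuous compactly supported functions**:
`∫ (∫ k(z) φ(x − z) dz)² dx ≤ (∫ |k|)² ∫ φ²` (Cauchy–Schwarz against the weight `|k(z)| dz`,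
Fubini, translation invariance). [folklore] -/
theorem integral_sq_integral_mul_comp_sub_le {k φ : (EuclideanSpace ℝ (Fin 3)) → ℝ} (hk : Continuous k)
    (hkc : HasCompactSupport k) (hφ : Continuous φ) (hφc : HasCompactSupport φ) :
    ∫ x, (∫ z, k z * φ (x - z)) ^ 2 ≤ (∫ z, |k z|) ^ 2 * ∫ x, φ x ^ 2 := by
  set K : ℝ := ∫ z, |k z| with hK
  have hK0 : 0 ≤ K := integral_nonneg fun z => abs_nonneg _
  have hki : Integrable k := hk.integrable_of_hasCompactSupport hkc
  -- pointwise Cauchy–Schwarz: `(∫ k φ_x)² ≤ K ∫ |k(z)| φ(x − z)²`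
  have hpt : ∀ x, (∫ z, k z * φ (x - z)) ^ 2 ≤ K * ∫ z, |k z| * φ (x - z) ^ 2 := by
    intro x
    have hφx : Continuous fun z => φ (x - z) := hφ.comp (continuous_const.sub continuous_id)
    set f : (EuclideanSpace ℝ (Fin 3)) → ℝ := fun z => Real.sqrt |k z| with hf
    set g : (EuclideanSpace ℝ (Fin 3)) → ℝ := fun z => Real.sqrt |k z| * |φ (x - z)| with hg
    have hfc : Continuous f := hk.abs.sqrt
    have hgc : Continuous g := hfc.mul hφx.abs
    have hfsupp : HasCompactSupport f := hkc.comp_left (g := fun t => Real.sqrt |t|) (by simp)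
    have hf2supp : HasCompactSupport fun z => f z ^ 2 :=
      hfsupp.comp_left (g := fun t : ℝ => t ^ 2) (by norm_num)
    have hgsupp : HasCompactSupport g := hfsupp.mul_right
    have hg2supp : HasCompactSupport fun z => g z ^ 2 :=
      hgsupp.comp_left (g := fun t : ℝ => t ^ 2) (by norm_num)
    have hf2 : ∀ z, f z ^ 2 = |k z| := fun z => Real.sq_sqrt (abs_nonneg _)
    have hg2 : ∀ z, g z ^ 2 = |k z| * φ (x - z) ^ 2 := fun z => by
      rw [hg, mul_pow, Real.sq_sqrt (abs_nonneg _), sq_abs]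
    have hfg : ∀ z, f z * g z = |k z| * |φ (x - z)| := fun z => by
      rw [hg, ← mul_assoc, ← sq, Real.sq_sqrt (abs_nonneg _)]
    have hCS := FourierNS.sq_integral_mul_le_of_integrable (μ := volume) (f := f) (g := g)
      ((hfc.pow 2).integrable_of_hasCompactSupport hf2supp)
      ((hgc.pow 2).integrable_of_hasCompactSupport hg2supp)
      ((hfc.mul hgc).integrable_of_hasCompactSupport hfsupp.mul_right)
    simp_rw [hfg, hf2, hg2] at hCS
    refine le_trans ?_ hCS
    have h1 : |∫ z, k z * φ (x - z)| ≤ ∫ z, |k z| * |φ (x - z)| := by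
      refine (abs_integral_le_integral_abs).trans (le_of_eq ?_)
      exact integral_congr_ae (Eventually.of_forall fun z => abs_mul _ _)
    calc (∫ z, k z * φ (x - z)) ^ 2 = |∫ z, k z * φ (x - z)| ^ 2 := (sq_abs _).symm
      _ ≤ (∫ z, |k z| * |φ (x - z)|) ^ 2 :=
          pow_le_pow_left₀ (abs_nonneg _) h1 2
  -- integrate and swap
  have hF : Continuous fun p : (EuclideanSpace ℝ (Fin 3)) × (EuclideanSpace ℝ (Fin 3)) => |k p.2| * φ (p.1 - p.2) ^ 2 :=
    (hk.comp continuous_snd).abs.mul ((hφ.comp (continuous_fst.sub continuous_snd)).pow 2)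
  have hFc : HasCompactSupport fun p : (EuclideanSpace ℝ (Fin 3)) × (EuclideanSpace ℝ (Fin 3)) => |k p.2| * φ (p.1 - p.2) ^ 2 := by
    refine HasCompactSupport.intro ((hφc.isCompact.add hkc.isCompact).prod hkc.isCompact) ?_
    rintro ⟨x, z⟩ hp
    simp only [mem_prod, not_and_or] at hp
    rcases hp with hx | hz
    · by_cases hz : z ∈ tsupport k
      · have hxz : x - z ∉ tsupport φ := fun h => hx ⟨x - z, h, z, hz, sub_add_cancel x z⟩
        simp [image_eq_zero_of_notMem_tsupport hxz]
      · simp [image_eq_zero_of_notMem_tsupport hz]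
    · simp [image_eq_zero_of_notMem_tsupport hz]
  have hFi : Integrable (uncurry fun x z : (EuclideanSpace ℝ (Fin 3)) => |k z| * φ (x - z) ^ 2) (volume.prod volume) :=
    hF.integrable_of_hasCompactSupport hFc
  have hswap := integral_integral_swap hFi
  have hinner : ∀ z, ∫ x, |k z| * φ (x - z) ^ 2 = |k z| * ∫ x, φ x ^ 2 := fun z => by
    rw [MeasureTheory.integral_const_mul]
    congr 1
    exact integral_sub_right_eq_self (fun x => φ x ^ 2) z
  calc ∫ x, (∫ z, k z * φ (x - z)) ^ 2
      ≤ ∫ x, K * ∫ z, |k z| * φ (x - z) ^ 2 := by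
        refine integral_mono_of_nonneg (Eventually.of_forall fun x => sq_nonneg _) ?_
          (Eventually.of_forall hpt)
        exact (hFi.integral_prod_left).const_mul K
    _ = K * ∫ z, ∫ x, |k z| * φ (x - z) ^ 2 := by
        rw [MeasureTheory.integral_const_mul, hswap]
    _ = K * (K * ∫ x, φ x ^ 2) := by
        simp_rw [hinner]
        rw [MeasureTheory.integral_mul_const, hK]
    _ = K ^ 2 * ∫ x, φ x ^ 2 := by ring

end Young

/-! ## The localised Newton potential of a compactly supported density -/

section NearPotential

variable {r : ℝ} {φ : (EuclideanSpace ℝ (Fin 3)) → ℝ}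

/-- The localised Newton potential `N_r φ = Γ₀ʳ * φ` is `Cⁿ` for `φ ∈ Cⁿ`. [folklore] -/
theorem contDiff_integral_newtonNear_mul_comp_sub (hr : 0 < r) (n : ℕ) (hφ : ContDiff ℝ n φ) :
    ContDiff ℝ n fun y => ∫ z, newtonNear r (2 * r) z * φ (y - z) :=
  contDiff_integral_smul_comp_sub (integrable_newtonNear hr.le (by linarith))
    (fun z hz => newtonNear_eq_zero hr.le (by linarith) hz.le) n hφ

/-- `N_r φ` is supported in `tsupport φ + B̄(0, 2r)`; in particular it has compact support when
`φ` does. [folklore] -/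
theorem hasCompactSupport_integral_newtonNear_smul_comp_sub {F : Type*} [NormedAddCommGroup F]
    [NormedSpace ℝ F] (hr : 0 < r) {g : (EuclideanSpace ℝ (Fin 3)) → F} (hgc : HasCompactSupport g) :
    HasCompactSupport fun y => ∫ z, newtonNear r (2 * r) z • g (y - z) := by
  refine HasCompactSupport.intro (hgc.isCompact.add (isCompact_closedBall (0 : (EuclideanSpace ℝ (Fin 3))) (2 * r))) ?_
  intro y hy
  refine integral_eq_zero_of_ae (Eventually.of_forall fun z => ?_)
  by_cases hz : 2 * r < ‖z‖
  · simp [newtonNear_eq_zero hr.le (by linarith : r < 2 * r) hz.le]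
  · have hz' : z ∈ closedBall (0 : (EuclideanSpace ℝ (Fin 3))) (2 * r) := mem_closedBall_zero_iff.2 (not_lt.1 hz)
    have hyz : y - z ∉ tsupport g := fun h => hy ⟨y - z, h, z, hz', sub_add_cancel y z⟩
    simp [image_eq_zero_of_notMem_tsupport hyz]

/-- Real-valued case of `hasCompactSupport_integral_newtonNear_smul_comp_sub`. [folklore] -/
theorem hasCompactSupport_integral_newtonNear_mul_comp_sub (hr : 0 < r)
    (hφc : HasCompactSupport φ) :
    HasCompactSupport fun y => ∫ z, newtonNear r (2 * r) z * φ (y - z) :=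
  hasCompactSupport_integral_newtonNear_smul_comp_sub hr hφc

/-- **`Δ(Γ₀ʳ * φ) = φ − λʳ * φ`** for `φ ∈ C²` (`Δ` under the integral, then the localised Green
formula `∫ Γ₀ Δψ = ψ(0) − ∫ λ ψ`, Gilbarg–Trudinger (2.17)). [cite: GilbargTrudinger2001, (2.17)] -/
theorem laplacian_integral_newtonNear_mul_comp_sub (hr : 0 < r) (hφ : ContDiff ℝ 2 φ) (y : (EuclideanSpace ℝ (Fin 3))) :
    (Δ fun y => ∫ z, newtonNear r (2 * r) z * φ (y - z)) y =
      φ y - ∫ z, newtonFarLaplacian r (2 * r) z * φ (y - z) := by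
  have h2r : r < 2 * r := by linarith
  rw [laplacian_integral_mul_comp_sub (integrable_newtonNear hr.le h2r)
    (fun z hz => newtonNear_eq_zero hr.le h2r hz.le) hφ y]
  have hφy : ContDiff ℝ 2 fun z => φ (y - z) := hφ.comp (contDiff_const.sub contDiff_id)
  have h2 := integral_newtonNear_mul_laplacian hr h2r hφy
  simp only [laplacian_comp_const_sub, sub_zero] at h2
  exact h2

/-- **`L²` bound for `Δ(Γ₀ʳ * φ)`**: `∫ (Δ N_rφ)² ≤ 2(1 + K₁²) ∫ φ²` whenever `∫|λʳ| ≤ K₁`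
(e.g. `K₁ = ∫|λ^{1,2}|`, scale-free: `integral_abs_newtonFarLaplacian_scale_eq`), for
`φ ∈ C²_c`. [folklore] -/
theorem integral_sq_laplacian_integral_newtonNear_le (hr : 0 < r) (hφ : ContDiff ℝ 2 φ)
    (hφc : HasCompactSupport φ) {K₁ : ℝ}
    (hK : ∫ z, |newtonFarLaplacian r (2 * r) z| ≤ K₁) :
    ∫ y, ((Δ fun y => ∫ z, newtonNear r (2 * r) z * φ (y - z)) y) ^ 2 ≤
      2 * (1 + K₁ ^ 2) * ∫ y, φ y ^ 2 := by
  have h2r : r < 2 * r := by linarith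
  have hlc : Continuous (newtonFarLaplacian r (2 * r)) := continuous_newtonFarLaplacian hr h2r
  have hlcs : HasCompactSupport (newtonFarLaplacian r (2 * r)) :=
    hasCompactSupport_newtonFarLaplacian hr.le h2r
  have hφ2c : HasCompactSupport fun y => φ y ^ 2 := by
    rw [show (fun y => φ y ^ 2) = φ * φ from funext fun y => by simp [sq]]
    exact hφc.mul_right
  have hφ2i : Integrable fun y => φ y ^ 2 := (hφ.continuous.pow 2).integrable_of_hasCompactSupport hφ2c
  have hI0 : 0 ≤ ∫ y, φ y ^ 2 := integral_nonneg fun y => sq_nonneg _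
  -- the convolution `λ * φ` is continuous with compact support
  have hNc : Continuous fun y => ∫ z, newtonFarLaplacian r (2 * r) z * φ (y - z) :=
    continuous_integral_smul_comp_sub (integrable_newtonFarLaplacian hr h2r)
      (fun z hz => newtonFarLaplacian_eq_zero_of_gt hr.le h2r hz) hφ.continuous
  have hNcs : HasCompactSupport fun y => ∫ z, newtonFarLaplacian r (2 * r) z * φ (y - z) := by
    refine HasCompactSupport.intro (hφc.isCompact.add (isCompact_closedBall (0 : (EuclideanSpace ℝ (Fin 3))) (2 * r))) ?_
    intro y hy
    refine integral_eq_zero_of_ae (Eventually.of_forall fun z => ?_)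
    by_cases hz : 2 * r < ‖z‖
    · simp [newtonFarLaplacian_eq_zero_of_gt hr.le h2r hz]
    · have hz' : z ∈ closedBall (0 : (EuclideanSpace ℝ (Fin 3))) (2 * r) := mem_closedBall_zero_iff.2 (not_lt.1 hz)
      have hyz : y - z ∉ tsupport φ := fun h => hy ⟨y - z, h, z, hz', sub_add_cancel y z⟩
      simp [image_eq_zero_of_notMem_tsupport hyz]
  have hconv2c : HasCompactSupport fun y => (∫ z, newtonFarLaplacian r (2 * r) z * φ (y - z)) ^ 2 := by
    rw [show (fun y => (∫ z, newtonFarLaplacian r (2 * r) z * φ (y - z)) ^ 2) =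
      (fun y => ∫ z, newtonFarLaplacian r (2 * r) z * φ (y - z)) *
        fun y => ∫ z, newtonFarLaplacian r (2 * r) z * φ (y - z) from funext fun y => by simp [sq]]
    exact hNcs.mul_right
  have hconv2i : Integrable fun y => (∫ z, newtonFarLaplacian r (2 * r) z * φ (y - z)) ^ 2 :=
    (hNc.pow 2).integrable_of_hasCompactSupport hconv2c
  have hY := integral_sq_integral_mul_comp_sub_le hlc hlcs hφ.continuous hφc
  have hY' : ∫ y, (∫ z, newtonFarLaplacian r (2 * r) z * φ (y - z)) ^ 2 ≤ K₁ ^ 2 * ∫ y, φ y ^ 2 :=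
    hY.trans (mul_le_mul_of_nonneg_right
      (pow_le_pow_left₀ (integral_nonneg fun z => abs_nonneg _) hK 2) hI0)
  have hΔ : ∀ y, (Δ fun y => ∫ z, newtonNear r (2 * r) z * φ (y - z)) y =
      φ y - ∫ z, newtonFarLaplacian r (2 * r) z * φ (y - z) :=
    fun y => laplacian_integral_newtonNear_mul_comp_sub hr hφ y
  simp_rw [hΔ]
  have hpt : ∀ y, (φ y - ∫ z, newtonFarLaplacian r (2 * r) z * φ (y - z)) ^ 2 ≤
      2 * φ y ^ 2 + 2 * (∫ z, newtonFarLaplacian r (2 * r) z * φ (y - z)) ^ 2 := fun y => by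
    have : 0 ≤ (φ y + ∫ z, newtonFarLaplacian r (2 * r) z * φ (y - z)) ^ 2 := sq_nonneg _
    linarith [show (φ y - ∫ z, newtonFarLaplacian r (2 * r) z * φ (y - z)) ^ 2 +
      (φ y + ∫ z, newtonFarLaplacian r (2 * r) z * φ (y - z)) ^ 2 =
      2 * φ y ^ 2 + 2 * (∫ z, newtonFarLaplacian r (2 * r) z * φ (y - z)) ^ 2 by ring]
  calc ∫ y, (φ y - ∫ z, newtonFarLaplacian r (2 * r) z * φ (y - z)) ^ 2
      ≤ ∫ y, (2 * φ y ^ 2 + 2 * (∫ z, newtonFarLaplacian r (2 * r) z * φ (y - z)) ^ 2) :=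
        integral_mono_of_nonneg (Eventually.of_forall fun y => sq_nonneg _)
          ((hφ2i.const_mul 2).add (hconv2i.const_mul 2)) (Eventually.of_forall hpt)
    _ = (2 * ∫ y, φ y ^ 2) + 2 * ∫ y, (∫ z, newtonFarLaplacian r (2 * r) z * φ (y - z)) ^ 2 := by
        rw [integral_add (hφ2i.const_mul 2) (hconv2i.const_mul 2),
          MeasureTheory.integral_const_mul, MeasureTheory.integral_const_mul]
    _ ≤ (2 * ∫ y, φ y ^ 2) + 2 * (K₁ ^ 2 * ∫ y, φ y ^ 2) :=
        add_le_add le_rfl (mul_le_mul_of_nonneg_left hY' (by norm_num : (0 : ℝ) ≤ 2))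
    _ = 2 * (1 + K₁ ^ 2) * ∫ y, φ y ^ 2 := by ring

/-- **`L²` bound for the Hessian of the localised Newton potential**:
`Σₐ Σ_b ∫ (∂_b∂ₐ N_rφ)² ≤ 2(1 + K₁²) ∫ φ²` for `φ ∈ C³_c` — the identity `Σ∫(∂ᵢ∂ⱼG)² = ∫(ΔG)²`
(`integral_sum_sq_fderiv_fderiv_eq_integral_laplacian_sq`, Stein 1970 Ch. III §1.3) for
`G = N_rφ ∈ C³_c` and the previous bound (Tao 2011, p. 32: "From Plancherel's theorem we have
`‖∇Δ⁻¹∇(ψᵢω)‖_{L²} ≲ ‖ψᵢω‖_{L²}`"). [cite: Tao2011, §10, proof of Thm. 10.1 (the bound for F_i)] -/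
theorem sum_integral_sq_fderiv_fderiv_integral_newtonNear_le (hr : 0 < r) (hφ : ContDiff ℝ 3 φ)
    (hφc : HasCompactSupport φ) {K₁ : ℝ}
    (hK : ∫ z, |newtonFarLaplacian r (2 * r) z| ≤ K₁) {ι : Type*} [Fintype ι]
    (b : OrthonormalBasis ι ℝ (EuclideanSpace ℝ (Fin 3))) :
    ∑ i, ∑ j, ∫ y, (fderiv ℝ (fun w => fderiv ℝ (fun y => ∫ z, newtonNear r (2 * r) z * φ (y - z)) w
        (b i)) y (b j)) ^ 2 ≤
      2 * (1 + K₁ ^ 2) * ∫ y, φ y ^ 2 := by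
  rw [integral_sum_sq_fderiv_fderiv_eq_integral_laplacian_sq b
    (contDiff_integral_newtonNear_mul_comp_sub hr 3 hφ)
    (hasCompactSupport_integral_newtonNear_mul_comp_sub hr hφc)]
  exact integral_sq_laplacian_integral_newtonNear_le hr (hφ.of_le (by norm_cast)) hφc hK

end NearPotential

/-! ## The vector potential `A = Γ₀ʳ * g` and the `L²` bound for `D(curl A)` -/

section VectorPotential

variable {r : ℝ} {g : (EuclideanSpace ℝ (Fin 3)) → (EuclideanSpace ℝ (Fin 3))}

/-- Coordinates of the vector potential are the scalar potentials of the coordinates: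
`(Γ₀ʳ * g)(y)ₘ = (Γ₀ʳ * gₘ)(y)`. [folklore] -/
theorem integral_newtonNear_smul_comp_sub_apply (hr : 0 < r) (hg : Continuous g) (y : (EuclideanSpace ℝ (Fin 3)))
    (m : Fin 3) :
    (∫ z, newtonNear r (2 * r) z • g (y - z)) m = ∫ z, newtonNear r (2 * r) z * g (y - z) m := by
  have hi : Integrable fun z => newtonNear r (2 * r) z • g (y - z) :=
    integrable_smul_comp_sub (integrable_newtonNear hr.le (by linarith))
      (fun z hz => newtonNear_eq_zero hr.le (by linarith : r < 2 * r) hz.le) hg y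
  have h := ((EuclideanSpace.proj m : (EuclideanSpace ℝ (Fin 3)) →L[ℝ] ℝ).integral_comp_comm hi).symm
  simpa using h

/-- **Pointwise: the vorticity-gradient of a field is controlled by its coordinate Hessians**:
for `A ∈ C²((EuclideanSpace ℝ (Fin 3)); (EuclideanSpace ℝ (Fin 3)))`, `‖D(curl A)(y)‖² ≤ ‖curlCLM‖² Σᵢ Σⱼ Σₘ (∂ᵢ∂ⱼAₘ(y))²`. [folklore] -/
theorem sq_norm_fderiv_curl_le_sum {A : (EuclideanSpace ℝ (Fin 3)) → (EuclideanSpace ℝ (Fin 3))} (hA : ContDiff ℝ 2 A) (y : (EuclideanSpace ℝ (Fin 3))) :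
    ‖fderiv ℝ (curl A) y‖ ^ 2 ≤
      ‖curlCLM‖ ^ 2 * ∑ i : Fin 3, ∑ j : Fin 3, ∑ m : Fin 3,
        (fderiv ℝ (fun w => fderiv ℝ (fun y => A y m) w (EuclideanSpace.single (j : Fin 3) (1 : ℝ))) y (EuclideanSpace.single (i : Fin 3) (1 : ℝ))) ^ 2 := by
  set b := EuclideanSpace.basisFun (Fin 3) ℝ with hb
  have hbi : ∀ i, b i = EuclideanSpace.single (i : Fin 3) (1 : ℝ) := fun i => by simp [hb]
  set T := fderiv ℝ (fderiv ℝ A) y with hT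
  rw [fderiv_curl hA y]
  have h1 : ‖curlCLM.comp T‖ ^ 2 ≤ ‖curlCLM‖ ^ 2 * ‖T‖ ^ 2 := by
    rw [← mul_pow]
    exact pow_le_pow_left₀ (norm_nonneg _) (ContinuousLinearMap.opNorm_comp_le _ _) 2
  refine h1.trans (mul_le_mul_of_nonneg_left ?_ (sq_nonneg _))
  have h2 : ‖T‖ ^ 2 ≤ ∑ i, ‖T (b i)‖ ^ 2 := sq_opNorm_le_sum_sq_norm_apply b T
  have h3 : ∀ i, ‖T (b i)‖ ^ 2 ≤ ∑ j, ‖T (b i) (b j)‖ ^ 2 := fun i =>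
    sq_opNorm_le_sum_sq_norm_apply b (T (b i))
  have h4 : ∀ i j, ‖T (b i) (b j)‖ ^ 2 = ∑ m, (T (b i) (b j) m) ^ 2 := fun i j => by
    rw [EuclideanSpace.norm_sq_eq]
    simp [sq_abs]
  have h5 : ∀ i j m, T (b i) (b j) m =
      fderiv ℝ (fun w => fderiv ℝ (fun y => A y m) w (EuclideanSpace.single (j : Fin 3) (1 : ℝ))) y (EuclideanSpace.single (i : Fin 3) (1 : ℝ)) := fun i j m => by
    rw [hT, hbi, hbi, ← fderiv_fderiv_apply_coord hA y (EuclideanSpace.single (j : Fin 3) (1 : ℝ)) (EuclideanSpace.single (i : Fin 3) (1 : ℝ)) m]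
    have hfun : (fun y => fderiv ℝ A y (EuclideanSpace.single (j : Fin 3) (1 : ℝ)) m) = fun w => fderiv ℝ (fun y => A y m) w (EuclideanSpace.single (j : Fin 3) (1 : ℝ)) := by
      funext w
      have hd : DifferentiableAt ℝ A w := (hA.differentiable (by norm_num)) w
      have : (fun y => A y m) = (EuclideanSpace.proj m : (EuclideanSpace ℝ (Fin 3)) →L[ℝ] ℝ) ∘ A := rfl
      rw [this, fderiv_comp w (EuclideanSpace.proj m : (EuclideanSpace ℝ (Fin 3)) →L[ℝ] ℝ).differentiableAt hd,
        ContinuousLinearMap.fderiv]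
      rfl
    rw [hfun]
  calc ‖T‖ ^ 2 ≤ ∑ i, ‖T (b i)‖ ^ 2 := h2
    _ ≤ ∑ i, ∑ j, ‖T (b i) (b j)‖ ^ 2 := Finset.sum_le_sum fun i _ => h3 i
    _ = ∑ i, ∑ j, ∑ m, (fderiv ℝ (fun w => fderiv ℝ (fun y => A y m) w (EuclideanSpace.single (j : Fin 3) (1 : ℝ))) y (EuclideanSpace.single (i : Fin 3) (1 : ℝ))) ^ 2 := by
        refine Finset.sum_congr rfl fun i _ => Finset.sum_congr rfl fun j _ => ?_
        rw [h4]
        exact Finset.sum_congr rfl fun m _ => by rw [h5]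

/-- **`L²` bound for the vorticity-gradient of the vector potential** `A = Γ₀ʳ * g`,
`g ∈ C³_c((EuclideanSpace ℝ (Fin 3)); (EuclideanSpace ℝ (Fin 3)))`: `∫ ‖D(curl A)‖² ≤ 2‖curlCLM‖²(1 + K₁²) ∫ |g|²` when `∫|λʳ| ≤ K₁` — the
`L²`-boundedness of the second derivatives of the localised Newton potential (Tao 2011, p. 32:
"`‖∇Δ⁻¹∇(ψᵢω)‖_{L²} ≲ ‖ψᵢω‖_{L²} ≲ ‖ω‖_{L²(2Bᵢ)}`", by Plancherel there; here by
`Σ∫(∂ᵢ∂ⱼG)² = ∫(ΔG)²`). [cite: Tao2011, §10, proof of Thm. 10.1 (the bound for F_i)] -/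
theorem integral_sq_norm_fderiv_curl_integral_newtonNear_le (hr : 0 < r) (hg : ContDiff ℝ 3 g)
    (hgc : HasCompactSupport g) {K₁ : ℝ} (hK : ∫ z, |newtonFarLaplacian r (2 * r) z| ≤ K₁) :
    ∫ y, ‖fderiv ℝ (curl fun y => ∫ z, newtonNear r (2 * r) z • g (y - z)) y‖ ^ 2 ≤
      ‖curlCLM‖ ^ 2 * (2 * (1 + K₁ ^ 2)) * ∫ y, ‖g y‖ ^ 2 := by
  have h2r : r < 2 * r := by linarith
  set A : (EuclideanSpace ℝ (Fin 3)) → (EuclideanSpace ℝ (Fin 3)) := fun y => ∫ z, newtonNear r (2 * r) z • g (y - z) with hAdef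
  have hA3 : ContDiff ℝ 3 A := contDiff_integral_smul_comp_sub (integrable_newtonNear hr.le h2r)
    (fun z hz => newtonNear_eq_zero hr.le h2r hz.le) 3 hg
  have hA2 : ContDiff ℝ 2 A := hA3.of_le (by norm_cast)
  -- coordinates
  have hgm : ∀ m : Fin 3, ContDiff ℝ 3 fun w => g w m := fun m =>
    (EuclideanSpace.proj m : (EuclideanSpace ℝ (Fin 3)) →L[ℝ] ℝ).contDiff.comp hg
  have hgmc : ∀ m : Fin 3, HasCompactSupport fun w => g w m := fun m =>
    hgc.mono fun w hw => by
      contrapose! hw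
      simp only [Function.mem_support, not_not] at hw ⊢
      simp [hw]
  have hAm : ∀ (m : Fin 3), (fun y => A y m) = fun y => ∫ z, newtonNear r (2 * r) z * g (y - z) m :=
    fun m => funext fun y => integral_newtonNear_smul_comp_sub_apply hr hg.continuous y m
  -- the coordinate Hessians are continuous with compact support, hence square integrable
  have hNm3 : ∀ m : Fin 3, ContDiff ℝ 3 fun y => ∫ z, newtonNear r (2 * r) z * g (y - z) m :=
    fun m => contDiff_integral_newtonNear_mul_comp_sub (φ := fun w => g w m) hr 3 (hgm m)
  have hNmc : ∀ m : Fin 3, HasCompactSupport fun y => ∫ z, newtonNear r (2 * r) z * g (y - z) m :=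
    fun m => hasCompactSupport_integral_newtonNear_mul_comp_sub (φ := fun w => g w m) hr (hgmc m)
  have hHi : ∀ i j m : Fin 3, Integrable fun y =>
      (fderiv ℝ (fun w => fderiv ℝ (fun y => A y m) w (EuclideanSpace.single (j : Fin 3) (1 : ℝ))) y (EuclideanSpace.single (i : Fin 3) (1 : ℝ))) ^ 2 := by
    intro i j m
    rw [hAm m]
    have hc := continuous_fderiv_fderiv_apply ((hNm3 m).of_le (by norm_cast)) (EuclideanSpace.single (j : Fin 3) (1 : ℝ)) (EuclideanSpace.single (i : Fin 3) (1 : ℝ))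
    have hcs := hasCompactSupport_fderiv_fderiv_apply (hNmc m) (EuclideanSpace.single (j : Fin 3) (1 : ℝ)) (EuclideanSpace.single (i : Fin 3) (1 : ℝ))
    refine (hc.pow 2).integrable_of_hasCompactSupport ?_
    rw [sq]
    exact hcs.mul_right
  -- integrate the pointwise bound
  have hpt := fun y => sq_norm_fderiv_curl_le_sum hA2 y
  have hsumInt : Integrable fun y => ‖curlCLM‖ ^ 2 * ∑ i : Fin 3, ∑ j : Fin 3, ∑ m : Fin 3,
      (fderiv ℝ (fun w => fderiv ℝ (fun y => A y m) w (EuclideanSpace.single (j : Fin 3) (1 : ℝ))) y (EuclideanSpace.single (i : Fin 3) (1 : ℝ))) ^ 2 :=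
    (integrable_finsetSum _ fun i _ => integrable_finsetSum _ fun j _ =>
      integrable_finsetSum _ fun m _ => hHi i j m).const_mul _
  have step1 : ∫ y, ‖fderiv ℝ (curl A) y‖ ^ 2 ≤
      ‖curlCLM‖ ^ 2 * ∑ i : Fin 3, ∑ j : Fin 3, ∑ m : Fin 3,
        ∫ y, (fderiv ℝ (fun w => fderiv ℝ (fun y => A y m) w (EuclideanSpace.single (j : Fin 3) (1 : ℝ))) y (EuclideanSpace.single (i : Fin 3) (1 : ℝ))) ^ 2 := by
    refine (integral_mono_of_nonneg (Eventually.of_forall fun y => sq_nonneg _) hsumInt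
      (Eventually.of_forall hpt)).trans (le_of_eq ?_)
    rw [MeasureTheory.integral_const_mul]
    congr 1
    rw [integral_finsetSum _ fun i _ => integrable_finsetSum _ fun j _ =>
      integrable_finsetSum _ fun m _ => hHi i j m]
    refine Finset.sum_congr rfl fun i _ => ?_
    rw [integral_finsetSum _ fun j _ => integrable_finsetSum _ fun m _ => hHi i j m]
    refine Finset.sum_congr rfl fun j _ => ?_
    rw [integral_finsetSum _ fun m _ => hHi i j m]
  -- the scalar bound, coordinate by coordinate
  have step2 : ∀ m : Fin 3, ∑ i : Fin 3, ∑ j : Fin 3,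
      ∫ y, (fderiv ℝ (fun w => fderiv ℝ (fun y => A y m) w (EuclideanSpace.single (j : Fin 3) (1 : ℝ))) y (EuclideanSpace.single (i : Fin 3) (1 : ℝ))) ^ 2 ≤
        2 * (1 + K₁ ^ 2) * ∫ y, (g y m) ^ 2 := by
    intro m
    have h := sum_integral_sq_fderiv_fderiv_integral_newtonNear_le (φ := fun w => g w m) hr (hgm m)
      (hgmc m) hK (EuclideanSpace.basisFun (Fin 3) ℝ)
    simp only [EuclideanSpace.basisFun_apply] at h
    rw [hAm m, Finset.sum_comm]
    exact h
  -- sum over the coordinates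
  have hg2m : ∀ m : Fin 3, Integrable fun y => (g y m) ^ 2 := fun m => by
    refine (((hgm m).continuous).pow 2).integrable_of_hasCompactSupport ?_
    rw [sq]
    exact (hgmc m).mul_right
  have step3 : ∑ m : Fin 3, ∫ y, (g y m) ^ 2 = ∫ y, ‖g y‖ ^ 2 := by
    rw [← integral_finsetSum _ fun m _ => hg2m m]
    refine integral_congr_ae (Eventually.of_forall fun y => ?_)
    simp only []
    rw [EuclideanSpace.norm_sq_eq]
    simp [sq_abs]
  calc ∫ y, ‖fderiv ℝ (curl A) y‖ ^ 2
      ≤ ‖curlCLM‖ ^ 2 * ∑ i : Fin 3, ∑ j : Fin 3, ∑ m : Fin 3,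
          ∫ y, (fderiv ℝ (fun w => fderiv ℝ (fun y => A y m) w (EuclideanSpace.single (j : Fin 3) (1 : ℝ))) y (EuclideanSpace.single (i : Fin 3) (1 : ℝ))) ^ 2 := step1
    _ = ‖curlCLM‖ ^ 2 * ∑ i : Fin 3, ∑ m : Fin 3, ∑ j : Fin 3,
          ∫ y, (fderiv ℝ (fun w => fderiv ℝ (fun y => A y m) w (EuclideanSpace.single (j : Fin 3) (1 : ℝ))) y (EuclideanSpace.single (i : Fin 3) (1 : ℝ))) ^ 2 := by
        congr 1
        exact Finset.sum_congr rfl fun i _ => Finset.sum_comm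
    _ = ‖curlCLM‖ ^ 2 * ∑ m : Fin 3, ∑ i : Fin 3, ∑ j : Fin 3,
          ∫ y, (fderiv ℝ (fun w => fderiv ℝ (fun y => A y m) w (EuclideanSpace.single (j : Fin 3) (1 : ℝ))) y (EuclideanSpace.single (i : Fin 3) (1 : ℝ))) ^ 2 := by
        congr 1
        exact Finset.sum_comm
    _ ≤ ‖curlCLM‖ ^ 2 * ∑ m : Fin 3, (2 * (1 + K₁ ^ 2) * ∫ y, (g y m) ^ 2) :=
        mul_le_mul_of_nonneg_left (Finset.sum_le_sum fun m _ => step2 m) (sq_nonneg _)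
    _ = ‖curlCLM‖ ^ 2 * (2 * (1 + K₁ ^ 2)) * ∫ y, ‖g y‖ ^ 2 := by
        rw [← Finset.mul_sum, step3]
        ring

end VectorPotential

section FarTerm

variable {F : Type*} [NormedAddCommGroup F] [NormedSpace ℝ F] [CompleteSpace F]

/-- **The derivative of the far term falls on the kernel**: for `u ∈ C¹((EuclideanSpace ℝ (Fin 3)); F)`, `r > 0`,
`∂ₐ (∫ λʳ(z) u(· − z) dz)(y) = ∫ ∂ₐλʳ(z) u(y − z) dz` (differentiation under the integral, then
one integration by parts without boundary terms, `λʳ ∈ C^∞_c`). [folklore] -/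
theorem fderiv_integral_newtonFarLaplacian_smul_apply {r : ℝ} (hr : 0 < r) {u : (EuclideanSpace ℝ (Fin 3)) → F}
    (hu : ContDiff ℝ 1 u) (y a : (EuclideanSpace ℝ (Fin 3))) :
    fderiv ℝ (fun x => ∫ z, newtonFarLaplacian r (2 * r) z • u (x - z)) y a =
      ∫ z, (fderiv ℝ (newtonFarLaplacian r (2 * r)) z a) • u (y - z) := by
  have h2r : r < 2 * r := by linarith
  set lam := newtonFarLaplacian r (2 * r) with hlam
  have hli : Integrable lam := integrable_newtonFarLaplacian hr h2r
  have hlz : ∀ z : (EuclideanSpace ℝ (Fin 3)), 2 * r < ‖z‖ → lam z = 0 := fun z hz => newtonFarLaplacian_eq_zero_of_gt hr.le h2r hz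
  rw [fderiv_integral_smul_comp_sub_apply hli hlz hu y a]
  -- integrate by parts in `z`
  set h : (EuclideanSpace ℝ (Fin 3)) → F := fun z => u (y - z) with hh
  have hh1 : ContDiff ℝ 1 h := hu.comp (contDiff_const.sub contDiff_id)
  have hDh : ∀ z, fderiv ℝ h z a = -fderiv ℝ u (y - z) a := fun z => by
    have : HasFDerivAt h ((fderiv ℝ u (y - z)).comp (-ContinuousLinearMap.id ℝ (EuclideanSpace ℝ (Fin 3)))) z := by
      have h1 := ((hu.differentiable one_ne_zero) (y - z)).hasFDerivAt
      have h2 : HasFDerivAt (fun z : (EuclideanSpace ℝ (Fin 3)) => y - z)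
          ((0 : (EuclideanSpace ℝ (Fin 3)) →L[ℝ] (EuclideanSpace ℝ (Fin 3))) - ContinuousLinearMap.id ℝ (EuclideanSpace ℝ (Fin 3))) z :=
        (hasFDerivAt_const y z).sub (hasFDerivAt_id z)
      rw [zero_sub] at h2
      exact h1.comp z h2
    rw [this.fderiv]
    simp
  have hlamc : HasCompactSupport lam := hasCompactSupport_newtonFarLaplacian hr.le h2r
  have hlams : ContDiff ℝ 1 lam := contDiff_newtonFarLaplacian hr h2r (n := 1)
  have hc1 : Continuous fun z => fderiv ℝ lam z a :=
    (hlams.continuous_fderiv one_ne_zero).clm_apply continuous_const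
  have hc2 : Continuous fun z => fderiv ℝ h z a :=
    (hh1.continuous_fderiv one_ne_zero).clm_apply continuous_const
  have hibp := integral_smul_fderiv_eq_neg_fderiv_smul_of_integrable (μ := volume) (f := lam)
    (g := h) (v := a)
    ((hc1.smul hh1.continuous).integrable_of_hasCompactSupport
      (hlamc.fderiv_apply (𝕜 := ℝ) a).smul_right)
    ((hlams.continuous.smul hc2).integrable_of_hasCompactSupport hlamc.smul_right)
    ((hlams.continuous.smul hh1.continuous).integrable_of_hasCompactSupport hlamc.smul_right)
    (fun z _ => (hlams.differentiable one_ne_zero) z)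
    (fun z _ => (hh1.differentiable one_ne_zero) z)
  simp_rw [hDh, smul_neg, integral_neg] at hibp
  rw [hh] at hibp
  have := neg_eq_iff_eq_neg.2 hibp
  rw [neg_neg] at this
  simpa only using this

/-- Reflection of a ball indicator through the centre: `1_{B(0,R)}(z) φ(y − z) = f(y − z)`
with `f = 1_{B(y,R)} φ`, and `∫ f(y − z) dz = ∫ f`; hence
`∫ 1_{B(0,R)}(z) φ(y − z) dz = ∫_{B(y,R)} φ`. [folklore] -/
theorem integral_indicator_ball_comp_sub (φ : (EuclideanSpace ℝ (Fin 3)) → ℝ) (y : (EuclideanSpace ℝ (Fin 3))) (R : ℝ) :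
    ∫ z, (ball (0 : (EuclideanSpace ℝ (Fin 3))) R).indicator (fun z => φ (y - z)) z = ∫ w in ball y R, φ w := by
  have h := integral_sub_left_eq_self ((ball y R).indicator φ) volume y
  rw [integral_indicator measurableSet_ball] at h
  rw [← h]
  refine integral_congr_ae (Eventually.of_forall fun z => ?_)
  simp only [indicator, mem_ball, dist_eq_norm, sub_sub_cancel_left, norm_neg, sub_zero]

/-- Local integrability of a continuous function on balls. [folklore] -/
theorem integrableOn_ball_of_continuous {G : Type*} [NormedAddCommGroup G] {φ : (EuclideanSpace ℝ (Fin 3)) → G}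
    (hφ : Continuous φ) (y : (EuclideanSpace ℝ (Fin 3))) (R : ℝ) : IntegrableOn φ (ball y R) :=
  (hφ.continuousOn.integrableOn_compact (isCompact_closedBall y R)).mono_set ball_subset_closedBall

/-- **Bound for the derivative of the far term**: with `‖Dλ^{1,2}‖ ≤ M₁`,
`‖D(∫ λʳ(z) u(· − z) dz)(y)‖ ≤ r⁻⁴ M₁ ∫_{B(y,3r)} ‖u‖` (Tao 2011, p. 32: the lower-order term
`r^{-5/2}‖u‖_{L²(2Bᵢ)}` of the pointwise estimate for `∇u`, here before Cauchy–Schwarz). [cite: Tao2011, §10, proof of Thm. 10.1 (local Biot–Savart law)] -/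
theorem norm_fderiv_integral_newtonFarLaplacian_smul_le {r : ℝ} (hr : 0 < r) {M₁ : ℝ}
    (hM₁ : 0 ≤ M₁) (hM : ∀ z : (EuclideanSpace ℝ (Fin 3)), ‖fderiv ℝ (newtonFarLaplacian 1 2) z‖ ≤ M₁) {u : (EuclideanSpace ℝ (Fin 3)) → F}
    (hu : ContDiff ℝ 1 u) (y : (EuclideanSpace ℝ (Fin 3))) :
    ‖fderiv ℝ (fun x => ∫ z, newtonFarLaplacian r (2 * r) z • u (x - z)) y‖ ≤
      r⁻¹ ^ 4 * M₁ * ∫ w in ball y (3 * r), ‖u w‖ := by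
  have h2r : r < 2 * r := by linarith
  have hI0 : 0 ≤ ∫ w in ball y (3 * r), ‖u w‖ := integral_nonneg fun _ => norm_nonneg _
  refine ContinuousLinearMap.opNorm_le_bound _ (by positivity) fun a => ?_
  rw [fderiv_integral_newtonFarLaplacian_smul_apply hr hu y a]
  have hsupp := tsupport_newtonFarLaplacian_subset hr.le h2r
  have hpt : ∀ z, ‖(fderiv ℝ (newtonFarLaplacian r (2 * r)) z a) • u (y - z)‖ ≤
      (ball (0 : (EuclideanSpace ℝ (Fin 3))) (3 * r)).indicator (fun z => ‖u (y - z)‖) z * (r⁻¹ ^ 4 * M₁ * ‖a‖) := by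
    intro z
    by_cases hz : z ∈ tsupport (newtonFarLaplacian r (2 * r))
    · have hz3 : z ∈ ball (0 : (EuclideanSpace ℝ (Fin 3))) (3 * r) := by
        have := hsupp hz
        rw [mem_closedBall_zero_iff] at this
        rw [mem_ball_zero_iff]
        linarith
      rw [indicator_of_mem hz3, norm_smul, mul_comm]
      refine mul_le_mul_of_nonneg_left ?_ (norm_nonneg _)
      calc ‖fderiv ℝ (newtonFarLaplacian r (2 * r)) z a‖
          ≤ ‖fderiv ℝ (newtonFarLaplacian r (2 * r)) z‖ * ‖a‖ := ContinuousLinearMap.le_opNorm _ _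
        _ ≤ r⁻¹ ^ 4 * M₁ * ‖a‖ :=
          mul_le_mul_of_nonneg_right (norm_fderiv_newtonFarLaplacian_scale_le hr hM z) (norm_nonneg _)
    · rw [fderiv_of_notMem_tsupport ℝ hz, _root_.zero_apply, zero_smul, norm_zero]
      exact mul_nonneg (indicator_nonneg (fun _ _ => norm_nonneg _) _) (by positivity)
  have hint : Integrable fun z => (ball (0 : (EuclideanSpace ℝ (Fin 3))) (3 * r)).indicator (fun z => ‖u (y - z)‖) z *
      (r⁻¹ ^ 4 * M₁ * ‖a‖) := by
    refine Integrable.mul_const ?_ _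
    exact (integrableOn_ball_of_continuous
      ((hu.continuous.comp (continuous_const.sub continuous_id)).norm) 0 (3 * r)).integrable_indicator
      measurableSet_ball
  calc ‖∫ z, (fderiv ℝ (newtonFarLaplacian r (2 * r)) z a) • u (y - z)‖
      ≤ ∫ z, (ball (0 : (EuclideanSpace ℝ (Fin 3))) (3 * r)).indicator (fun z => ‖u (y - z)‖) z * (r⁻¹ ^ 4 * M₁ * ‖a‖) :=
        norm_integral_le_of_norm_le hint (Eventually.of_forall hpt)
    _ = (∫ w in ball y (3 * r), ‖u w‖) * (r⁻¹ ^ 4 * M₁ * ‖a‖) := by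
        rw [integral_mul_const, integral_indicator_ball_comp_sub (fun w => ‖u w‖) y (3 * r)]
    _ = r⁻¹ ^ 4 * M₁ * (∫ w in ball y (3 * r), ‖u w‖) * ‖a‖ := by ring

end FarTerm

/-! ## The localised Green representation formula, vector form -/

section Representation

variable {F : Type*} [NormedAddCommGroup F] [InnerProductSpace ℝ F] [CompleteSpace F]

/-- **Localised Green representation formula (vector form).** For `g ∈ C²((EuclideanSpace ℝ (Fin 3)); F)`, `r > 0`
and every `y`:
`g(y) = ∫ Γ₀ʳ(z) (Δg)(y − z) dz + ∫ λʳ(z) g(y − z) dz`, `Γ₀ʳ = θΓ` the Newton kernel cut off at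
radii `(r, 2r)` and `λʳ = Δ((1−θ)Γ)` (smooth, supported in `r ≤ ‖z‖ ≤ 2r`, unit mass) — the
scalar identity `∫ Γ₀ Δφ = φ(0) − ∫ λ φ` (`integral_newtonNear_mul_laplacian`,
Gilbarg–Trudinger (2.17)) applied to `φ = ⟪c, g(y − ·)⟫` for every `c`. [cite: GilbargTrudinger2001, (2.17)] -/
theorem eq_integral_newtonNear_smul_laplacian_add {r : ℝ} (hr : 0 < r) {g : (EuclideanSpace ℝ (Fin 3)) → F}
    (hg : ContDiff ℝ 2 g) (y : (EuclideanSpace ℝ (Fin 3))) :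
    g y = (∫ z, newtonNear r (2 * r) z • (Δ g) (y - z)) +
      ∫ z, newtonFarLaplacian r (2 * r) z • g (y - z) := by
  have h2r : r < 2 * r := by linarith
  have hΔc : Continuous (Δ g) := FluidPDE.continuous_laplacian hg
  -- integrability of both integrands
  have hi1 : Integrable fun z => newtonNear r (2 * r) z • (Δ g) (y - z) :=
    integrable_smul_comp_sub (integrable_newtonNear hr.le h2r)
      (fun z hz => newtonNear_scale_eq_zero hr hz) hΔc y
  have hi2 : Integrable fun z => newtonFarLaplacian r (2 * r) z • g (y - z) :=
    integrable_smul_comp_sub (integrable_newtonFarLaplacian hr h2r)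
      (fun z hz => newtonFarLaplacian_scale_eq_zero hr hz) hg.continuous y
  -- test against every vector `c`
  refine ext_inner_left ℝ fun c => ?_
  set φ : (EuclideanSpace ℝ (Fin 3)) → ℝ := fun z => ⟪c, g (y - z)⟫ with hφ
  have hgy : ContDiff ℝ 2 fun z => g (y - z) := hg.comp (contDiff_const.sub contDiff_id)
  have hφ2 : ContDiff ℝ 2 φ := contDiff_const.inner ℝ hgy
  have key := integral_newtonNear_mul_laplacian hr h2r hφ2
  -- `Δφ(z) = ⟪c, (Δg)(y − z)⟫`
  have hΔφ : ∀ z, (Δ φ) z = ⟪c, (Δ g) (y - z)⟫ := fun z => by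
    have h1 : φ = (innerSL ℝ c : F →L[ℝ] ℝ) ∘ fun z => g (y - z) := by
      funext z; simp [hφ]
    rw [h1, (hgy.contDiffAt (x := z)).laplacian_CLM_comp_left, Function.comp_apply,
      laplacian_comp_const_sub]
    rfl
  simp_rw [hΔφ] at key
  rw [hφ] at key
  simp only [sub_zero] at key
  rw [inner_add_right, ← integral_inner hi1, ← integral_inner hi2]
  simp_rw [inner_smul_right]
  linarith

end Representation

/-! ## Locality and the local velocity-gradient bound -/

section Local

/-- **`curl` is local**: fields that agree near a point have the same curl there. [folklore] -/
theorem curl_congr_of_eventuallyEq {f g : (EuclideanSpace ℝ (Fin 3)) → (EuclideanSpace ℝ (Fin 3))} {w : (EuclideanSpace ℝ (Fin 3))} (h : f =ᶠ[𝓝 w] g) :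
    curl f w = curl g w := by
  rw [curl_eq_curlCLM, curl_eq_curlCLM, h.fderiv_eq]

/-- **`curl` passes under the localised Newton potential**: for `g ∈ C¹((EuclideanSpace ℝ (Fin 3)); (EuclideanSpace ℝ (Fin 3)))`,
`curl (Γ₀ʳ * g)(y) = ∫ Γ₀ʳ(z) (curl g)(y − z) dz`. [folklore] -/
theorem curl_integral_newtonNear_smul_comp_sub {r : ℝ} (hr : 0 < r) {g : (EuclideanSpace ℝ (Fin 3)) → (EuclideanSpace ℝ (Fin 3))}
    (hg : ContDiff ℝ 1 g) (y : (EuclideanSpace ℝ (Fin 3))) :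
    curl (fun y => ∫ z, newtonNear r (2 * r) z • g (y - z)) y =
      ∫ z, newtonNear r (2 * r) z • curl g (y - z) := by
  have h2r : r < 2 * r := by linarith
  have hΓi : Integrable (newtonNear r (2 * r)) := integrable_newtonNear hr.le h2r
  have hΓz : ∀ z : (EuclideanSpace ℝ (Fin 3)), 2 * r < ‖z‖ → newtonNear r (2 * r) z = 0 :=
    fun z hz => newtonNear_eq_zero hr.le h2r hz.le
  rw [curl_eq_curlCLM, fderiv_integral_smul_comp_sub hΓi hΓz hg y,
    ← curlCLM.integral_comp_comm (integrable_smul_comp_sub hΓi hΓz (hg.continuous_fderiv one_ne_zero) y)]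
  refine integral_congr_ae (Eventually.of_forall fun z => ?_)
  simp only [map_smul, curl_eq_curlCLM]

/-- **The local velocity-gradient bound** (Tao 2011, §10, p. 32, the pointwise estimate
"`|∇u| ≲ |∇Δ⁻¹∇(ψᵢω)| + rᵢ^{-3/2}‖ω‖_{L²(2Bᵢ)} + rᵢ^{-5/2}‖u‖_{L²(2Bᵢ)}` on `Bᵢ`" with
"`‖∇Δ⁻¹∇(ψᵢω)‖_{L²} ≲ ‖ω‖_{L²(2Bᵢ)}`", in the following boundary-free form). There is an
absolute constant `C` such that for every divergence-free `u ∈ C⁴((EuclideanSpace ℝ (Fin 3)); (EuclideanSpace ℝ (Fin 3)))`, every centre `x₀`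
and radius `r > 0` there is a continuous `F ≥ 0` with
`∫ F² ≤ C ∫_{B(x₀,9r)} |ω|²` (`ω = curl u`) and
`‖Du(y)‖ ≤ F(y) + C r⁻⁴ ∫_{B(y,3r)} |u|` for all `y ∈ B(x₀, r)`.
Proof: the localised Green formula `u = Γ₀ʳ * Δu + λʳ * u` with `Δu = −curl ω` (divergence
free) and the locality of `Γ₀ʳ` give `u = −curl(Γ₀ʳ * (ψω)) + λʳ * u` on `B(x₀, 2r)` for a
cutoff `ψ = 1` on `B(x₀, 4r)`; `F = ‖D curl(Γ₀ʳ * (ψω))‖` is bounded in `L²` by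
`Σ∫(∂ᵢ∂ⱼ·)² = ∫(Δ·)²` and Young's inequality, and `‖D(λʳ * u)‖ ≤ r⁻⁴‖Dλ‖_∞ ∫_{B(y,3r)}|u|`. [cite: Tao2011, §10, proof of Thm. 10.1 (local Biot–Savart law, p. 32)] -/
theorem exists_local_velocityGradient_bound :
    ∃ C : ℝ, 0 < C ∧ ∀ ⦃u : (EuclideanSpace ℝ (Fin 3)) → (EuclideanSpace ℝ (Fin 3))⦄, ContDiff ℝ 4 u → VectorCalculus.IsDivFree u →
      ∀ (x₀ : (EuclideanSpace ℝ (Fin 3))) ⦃r : ℝ⦄, 0 < r →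
        ∃ F : (EuclideanSpace ℝ (Fin 3)) → ℝ, Continuous F ∧ (∀ y, 0 ≤ F y) ∧ Integrable (fun y => F y ^ 2) ∧
          ∫ y, F y ^ 2 ≤ C * ∫ y in ball x₀ (9 * r), ‖curl u y‖ ^ 2 ∧
          ∀ y ∈ ball x₀ r, ‖fderiv ℝ u y‖ ≤ F y + C * r⁻¹ ^ 4 * ∫ w in ball y (3 * r), ‖u w‖ := by
  obtain ⟨M₁, hM₁0, hM₁⟩ := exists_bound_fderiv_newtonFarLaplacian_one_two
  set K₁ : ℝ := ∫ w, |newtonFarLaplacian 1 2 w| with hK₁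
  set C : ℝ := max (max (‖curlCLM‖ ^ 2 * (2 * (1 + K₁ ^ 2))) M₁) 1 with hC
  have hC1 : 1 ≤ C := le_max_right _ _
  have hC0 : 0 < C := one_pos.trans_le hC1
  have hCA : ‖curlCLM‖ ^ 2 * (2 * (1 + K₁ ^ 2)) ≤ C := (le_max_left _ _).trans (le_max_left _ _)
  have hCM : M₁ ≤ C := (le_max_right _ _).trans (le_max_left _ _)
  refine ⟨C, hC0, fun u hu hdiv x₀ r hr => ?_⟩
  have h2r : r < 2 * r := by linarith
  have h4r : 0 < 4 * r := by linarith
  -- smoothness levels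
  have hu2 : ContDiff ℝ 2 u := hu.of_le (by norm_cast)
  have hu1 : ContDiff ℝ 1 u := hu.of_le (by norm_cast)
  have hω3 : ContDiff ℝ 3 (curl u) := contDiff_curl (n := 3) (by exact_mod_cast hu)
  have hω1 : ContDiff ℝ 1 (curl u) := hω3.of_le (by norm_cast)
  -- the cutoff and the localised vorticity `g = ψ ω`
  set ψ : (EuclideanSpace ℝ (Fin 3)) → ℝ := fun w => cutoff (4 * r) (w - x₀) with hψ
  have hψs : ContDiff ℝ 3 ψ := (contDiff_cutoff (n := 3) (4 * r)).comp (contDiff_id.sub contDiff_const)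
  have hψ1 : ∀ w ∈ ball x₀ (4 * r), ψ w = 1 := fun w hw => by
    rw [mem_ball, dist_eq_norm] at hw
    exact cutoff_eq_one h4r hw.le
  have hψ0 : ∀ w, w ∉ ball x₀ (9 * r) → ψ w = 0 := fun w hw => by
    rw [mem_ball, dist_eq_norm, not_lt] at hw
    exact cutoff_eq_zero h4r (by linarith)
  set g : (EuclideanSpace ℝ (Fin 3)) → (EuclideanSpace ℝ (Fin 3)) := fun w => ψ w • curl u w with hg
  have hg3 : ContDiff ℝ 3 g := hψs.smul hω3
  have hg1 : ContDiff ℝ 1 g := hg3.of_le (by norm_cast)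
  have hgc : HasCompactSupport g := by
    refine HasCompactSupport.intro (isCompact_closedBall x₀ (9 * r)) fun w hw => ?_
    have : w ∉ ball x₀ (9 * r) := fun h => hw (ball_subset_closedBall h)
    simp [hg, hψ0 w this]
  have hgω : ∀ w ∈ ball x₀ (4 * r), curl g w = curl (curl u) w := fun w hw => by
    refine curl_congr_of_eventuallyEq ?_
    filter_upwards [isOpen_ball.mem_nhds hw] with w' hw'
    simp [hg, hψ1 w' hw']
  -- the vector potential and `F`
  set A : (EuclideanSpace ℝ (Fin 3)) → (EuclideanSpace ℝ (Fin 3)) := fun y => ∫ z, newtonNear r (2 * r) z • g (y - z) with hA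
  have hΓi : Integrable (newtonNear r (2 * r)) := integrable_newtonNear hr.le h2r
  have hΓz : ∀ z : (EuclideanSpace ℝ (Fin 3)), 2 * r < ‖z‖ → newtonNear r (2 * r) z = 0 :=
    fun z hz => newtonNear_eq_zero hr.le h2r hz.le
  have hA3 : ContDiff ℝ 3 A := contDiff_integral_smul_comp_sub hΓi hΓz 3 hg3
  have hAc : HasCompactSupport A := hasCompactSupport_integral_newtonNear_smul_comp_sub hr hgc
  have hcA2 : ContDiff ℝ 2 (curl A) := contDiff_curl (n := 2) (by exact_mod_cast hA3)
  have hcA1 : ContDiff ℝ 1 (curl A) := hcA2.of_le (by norm_cast)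
  set F : (EuclideanSpace ℝ (Fin 3)) → ℝ := fun y => ‖fderiv ℝ (curl A) y‖ with hF
  have hFc : Continuous F := (hcA1.continuous_fderiv one_ne_zero).norm
  have hFcs : HasCompactSupport F := ((hasCompactSupport_curl hAc).fderiv (𝕜 := ℝ)).norm
  have hF2i : Integrable fun y => F y ^ 2 := by
    refine (hFc.pow 2).integrable_of_hasCompactSupport ?_
    rw [sq]
    exact hFcs.mul_right
  -- the far term `Λ = λʳ * u`
  set Λ : (EuclideanSpace ℝ (Fin 3)) → (EuclideanSpace ℝ (Fin 3)) := fun y => ∫ z, newtonFarLaplacian r (2 * r) z • u (y - z) with hΛ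
  have hΛ1 : ContDiff ℝ 1 Λ := contDiff_integral_smul_comp_sub (integrable_newtonFarLaplacian hr h2r)
    (fun z hz => newtonFarLaplacian_eq_zero_of_gt hr.le h2r hz) 1 hu1
  -- the representation `u = -curl A + Λ` on `B(x₀, 2r)`
  have hrepr : ∀ y ∈ ball x₀ (2 * r), u y = -curl A y + Λ y := by
    intro y hy
    have h1 := eq_integral_newtonNear_smul_laplacian_add hr hu2 y
    have h2 : ∀ z, newtonNear r (2 * r) z • (Δ u) (y - z) =
        -(newtonNear r (2 * r) z • curl g (y - z)) := by
      intro z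
      by_cases hz : 2 * r ≤ ‖z‖
      · simp [newtonNear_eq_zero hr.le h2r hz]
      · have hyz : y - z ∈ ball x₀ (4 * r) := by
          rw [mem_ball, dist_eq_norm] at hy ⊢
          calc ‖y - z - x₀‖ = ‖(y - x₀) - z‖ := by abel_nf
            _ ≤ ‖y - x₀‖ + ‖z‖ := norm_sub_le _ _
            _ < 2 * r + 2 * r := add_lt_add hy (not_le.1 hz)
            _ = 4 * r := by ring
        rw [laplacian_eq_neg_curl_curl hu2 hdiv, hgω _ hyz, smul_neg]
    simp_rw [h2, integral_neg] at h1
    rw [h1, curl_integral_newtonNear_smul_comp_sub hr hg1 y]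
  -- differentiate on the open ball
  have hDu : ∀ y ∈ ball x₀ r, fderiv ℝ u y = -fderiv ℝ (curl A) y + fderiv ℝ Λ y := by
    intro y hy
    have hy2 : y ∈ ball x₀ (2 * r) := ball_subset_ball (by linarith) hy
    have hev : u =ᶠ[𝓝 y] fun y => -curl A y + Λ y := by
      filter_upwards [isOpen_ball.mem_nhds hy2] with y' hy'
      exact hrepr y' hy'
    rw [hev.fderiv_eq]
    have hd1 : DifferentiableAt ℝ (curl A) y := (hcA1.differentiable one_ne_zero) y
    have hd2 : DifferentiableAt ℝ Λ y := (hΛ1.differentiable one_ne_zero) y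
    exact (hd1.hasFDerivAt.neg.add hd2.hasFDerivAt).fderiv
  refine ⟨F, hFc, fun y => norm_nonneg _, hF2i, ?_, fun y hy => ?_⟩
  · -- the `L²` bound
    have hK : ∫ z, |newtonFarLaplacian r (2 * r) z| ≤ K₁ :=
      (integral_abs_newtonFarLaplacian_scale_eq hr).le
    have hAbd := integral_sq_norm_fderiv_curl_integral_newtonNear_le hr hg3 hgc hK
    have hgω2 : ∫ y, ‖g y‖ ^ 2 ≤ ∫ y in ball x₀ (9 * r), ‖curl u y‖ ^ 2 := by
      rw [← integral_indicator measurableSet_ball]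
      refine integral_mono_of_nonneg (Eventually.of_forall fun y => sq_nonneg _) ?_
        (Eventually.of_forall fun y => ?_)
      · exact ((integrableOn_ball_of_continuous (hω1.continuous.norm.pow 2) x₀ (9 * r)).integrable_indicator
          measurableSet_ball)
      · by_cases hyb : y ∈ ball x₀ (9 * r)
        · rw [indicator_of_mem hyb, hg]
          simp only [norm_smul, mul_pow, Real.norm_eq_abs]
          have h1 : |ψ y| ≤ 1 := abs_cutoff_le_one _ _
          have : |ψ y| ^ 2 ≤ 1 := by nlinarith [abs_nonneg (ψ y)]
          nlinarith [sq_nonneg ‖curl u y‖]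
        · rw [indicator_of_notMem hyb, hg]
          simp [hψ0 y hyb]
    have hω0 : 0 ≤ ∫ y in ball x₀ (9 * r), ‖curl u y‖ ^ 2 := integral_nonneg fun y => sq_nonneg _
    calc ∫ y, F y ^ 2 ≤ ‖curlCLM‖ ^ 2 * (2 * (1 + K₁ ^ 2)) * ∫ y, ‖g y‖ ^ 2 := hAbd
      _ ≤ C * ∫ y in ball x₀ (9 * r), ‖curl u y‖ ^ 2 :=
        mul_le_mul hCA hgω2 (integral_nonneg fun y => sq_nonneg _) hC0.le
  · -- the pointwise bound
    rw [hDu y hy]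
    have hΛb := norm_fderiv_integral_newtonFarLaplacian_smul_le hr hM₁0 hM₁ hu1 y
    have hI0 : 0 ≤ ∫ w in ball y (3 * r), ‖u w‖ := integral_nonneg fun _ => norm_nonneg _
    calc ‖-fderiv ℝ (curl A) y + fderiv ℝ Λ y‖ ≤ ‖-fderiv ℝ (curl A) y‖ + ‖fderiv ℝ Λ y‖ :=
          norm_add_le _ _
      _ ≤ F y + r⁻¹ ^ 4 * M₁ * ∫ w in ball y (3 * r), ‖u w‖ := by
          rw [norm_neg]
          exact add_le_add le_rfl hΛb
      _ ≤ F y + C * r⁻¹ ^ 4 * ∫ w in ball y (3 * r), ‖u w‖ := by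
          have : r⁻¹ ^ 4 * M₁ ≤ C * r⁻¹ ^ 4 := by
            rw [mul_comm]
            exact mul_le_mul_of_nonneg_right hCM (by positivity)
          nlinarith

end Local

end Literature.Analysis.FluidPDE

end
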